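import Literature.NumberTheory.LFunctions.Zhang2022.PartIConstraints

/-!
# Zhang (2022) Part I (§§2–6): the two parameter conditions added by the cell's part1-v4

Trunk T-ANT (NumberTheory/LFunctions). Y. Zhang, *Discrete mean estimates and the Landau–Siegel
zero*, arXiv:2211.02515v1 (2022) [Zhang2022LandauSiegel] — an unrefereed manuscript under
adjudication (cell pub-zhang: audit + repair census; **no claim about Landau–Siegel**). **Nothing in
this file asserts or denies any analytic statement of the manuscript** (Theorems 1–2, Props. 2.1–2.2,
Lemma 2.3, Lemmas 3.1–6.1); like `PartIConstraints` it records PARAMETER BOOKKEEPING only, and it is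
ADDITIVE: no declaration of `PartIConstraints` (`PartIDesign`, `Admissible`, `AdmissibleR5`,
`lt_of_admissibleR5`, `admissibleR5_1852`, `least_integer_A_R5`, …) or of `PartIFloorK9` is modified
or restated with a different meaning.

A display-by-display coverage audit of §§1–6 of the manuscript against the cell's Part-I row file
(`constraints/part1.json`, version part1-v3 = the Part-I input of the frozen `CONSTRAINTS-v6 … v9`)
found exactly two parameter-bearing steps whose condition no numbered display states and no row
carried. Version part1-v4 adds them (rows **I-L4.5b**, **I-6.02b**; merged freeze `CONSTRAINTS-v10`),
and this file is their Lean face: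

* `PartIDesign.CaseSplitRow45` — **I-L4.5b**, Lemma 4.5, Case 1 (`1/2 + 𝓛⁻¹ ≤ σ < 1`, p. 9): Lemma 4.2
  and (4.5) give `ℬ ≪ D^c · P^{1−2σ} = P^{1/2−σ} · [D^c P^{−(σ−1/2)}]`, and the printed
  "`ℬ ≪ P^{1/2−σ}`" needs the bracket `≤ 1` down to the case threshold `σ − 1/2 = 𝓛⁻¹`, i.e.
  `exp(c𝓛 − 𝓛^{eP−1}) ≤ 1`: **`eP − 1 > 1`**. (The threshold is the half-width of `Ω₂` as printed; in
  substance any threshold `≥ C𝓛^{1−eP}` runs, so the lemma needs only `eP > 1` — the row records the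
  split AS PRINTED.)
* `PartIDesign.FarContourRow62` — **I-6.02b**, (6.2) in the proof of Lemma 6.1 (p. 12): the contour is
  moved to `u = −𝓛⁹ = −𝓛^{eP}`, `|v| ≤ 𝓛^{20}`, and the "trivial bound for `ω₁(w)`" used there is
  `|ω₁(u+iv)| = exp((u² − v²)/(4𝓛^{eom1})) ≤ exp(𝓛^{2eP − eom1}/4)`, which is `O(1)` iff
  **`2·eP ≤ eom1`** (`18 ≤ 30` as printed).

What the kernel adds to the cell's bookkeeping (all `norm_num`/`linarith` arithmetic):

* `three_lt_eP_of_section5Rows` — I-L4.5b is IMPLIED by rows already in the kernel: Lemma 5.8's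
  `ea2 = min(A, 2eP − 3)` and `eP < ea2` (conjuncts of `Section5Rows`) force `eP > 3 > 2`; hence
  `admissibleV4_iff : AdmissibleV4 ↔ AdmissibleR5 ∧ FarContourRow62`.
* `admissible_not_farContourRow62` — I-6.02b is NOT implied: the printed design with
  `(eom1, eg) := (17, 17/2)` satisfies every v2-row (`Admissible`) and every (13.3)-form row
  (`AdmissibleR5`) and violates `2eP ≤ eom1`. So part1-v4 adds exactly one independent condition.
* `three_mul_eP_lt_two_mul_ev` — the one new coupling it creates: with the `ε`-rows
  (`eeps ≤ 2ev − eom1`, `eP < eeps`) the far-contour row gives `3eP < 2ev` (`27 < 40` as printed).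
* `printedI_admissibleV4`, `lt_of_admissibleV4`, `admissibleV4_1852`, `least_integer_A_V4` — the
  printed design satisfies the v4 rows; the Part-I floor on `A` in the (13.3) form is UNCHANGED by
  them (`185173/100 < A`, least integer `1852`, the witness of `admissibleR5_1852` having
  `2·9 ≤ 30`): the kernel twin of the cell's statement that CONSTRAINTS-v10 leaves every admissible-
  region projection of v9 unchanged.

None of this bears on the cell's verdict: the failing step of the manuscript is the exponent-free
numerical inequality (8.24) (`Section8Certificate.not_ineq824`), downstream of everything here.
-/

noncomputable section

namespace Literature.NumberTheory.LFunctions.Zhang2022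

namespace PartIDesign

/-- **Row I-L4.5b** (Lemma 4.5, Case 1, as printed): the factor `D^c` of Lemma 4.2 is absorbed into
`P^{1/2−σ}` down to the case threshold `σ − 1/2 = 𝓛⁻¹`, i.e. `𝓛^{eP−1}` beats `c𝓛`: `2 < eP`.
[cite: Zhang2022LandauSiegel, §4, Lemma 4.5 (Case 1), (4.5), Lemma 4.2] -/
def CaseSplitRow45 (p : PartIDesign) : Prop := 2 < p.eP

/-- **Row I-6.02b** ((6.2), proof of Lemma 6.1, as printed): on the far contour `u = −𝓛^{eP}` the
weight `ω₁(w) = exp(w²/(4𝓛^{eom1}))` is trivially bounded iff `u² ≤ 𝓛^{eom1}`: `2·eP ≤ eom1`.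
[cite: Zhang2022LandauSiegel, §6 (6.2), §4 (4.1)] -/
def FarContourRow62 (p : PartIDesign) : Prop := 2 * p.eP ≤ p.eom1

/-- The two rows that part1-v4 of the cell's Part-I census adds to part1-v3 [I-L4.5b, I-6.02b].
[cite: Zhang2022LandauSiegel, Lemma 4.5, (6.2)] -/
def RowsV4 (p : PartIDesign) : Prop := p.CaseSplitRow45 ∧ p.FarContourRow62

/-- `AdmissibleV4 p`: every Part-I row of the cell's CONSTRAINTS-v10 at the design/exponent layer —
the (13.3)-form conjunction `AdmissibleR5` (unchanged) and the two part1-v4 rows.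
[cite: Zhang2022LandauSiegel, §§2–6, (13.3)] -/
def AdmissibleV4 (p : PartIDesign) : Prop := p.AdmissibleR5 ∧ p.RowsV4

/-! ### I-L4.5b is implied by Lemma 5.8's rows -/

/-- Lemma 5.8's Taylor rows `ea2 = min(A, 2eP − 3)`, `eP < ea2` (conjuncts of `Section5Rows`,
rows I-L5.8a/b) force `eP > 3`. [folklore] -/
theorem three_lt_eP_of_section5Rows (p : PartIDesign) (h : p.Section5Rows) : 3 < p.eP := by
  obtain ⟨-, -, -, -, -, -, -, -, -, -, -, -, h13, h14, -, -⟩ := h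
  have hmin := min_le_right p.A (2 * p.eP - 3)
  rw [h13] at h14
  linarith

/-- Hence row I-L4.5b holds on every design satisfying the §5 rows. [folklore] -/
theorem caseSplitRow45_of_section5Rows (p : PartIDesign) (h : p.Section5Rows) : p.CaseSplitRow45 := by
  have h3 := three_lt_eP_of_section5Rows p h
  unfold CaseSplitRow45
  linarith

/-- … in particular on every v2-admissible design. [folklore] -/
theorem caseSplitRow45_of_admissible (p : PartIDesign) (h : p.Admissible) : p.CaseSplitRow45 :=
  caseSplitRow45_of_section5Rows p h.2.2.2.1

/-- … and on every (13.3)-form admissible design. [folklore] -/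
theorem caseSplitRow45_of_admissibleR5 (p : PartIDesign) (h : p.AdmissibleR5) : p.CaseSplitRow45 :=
  caseSplitRow45_of_section5Rows p h.2.2.2.1

/-- So the v4 conjunction is the R5 conjunction plus the far-contour row alone. [folklore] -/
theorem admissibleV4_iff (p : PartIDesign) : p.AdmissibleV4 ↔ p.AdmissibleR5 ∧ p.FarContourRow62 :=
  ⟨fun h => ⟨h.1, h.2.2⟩, fun h => ⟨h.1, caseSplitRow45_of_admissibleR5 p h.1, h.2⟩⟩

/-! ### I-6.02b is independent of the earlier rows -/

/-- The printed design with `ω₁`'s scale lowered to `𝓛^{17}` (`eom1 = 17 = 2·eg`) satisfies every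
v2 row and every (13.3)-form row, yet violates `2·eP ≤ eom1` (`18 ≤ 17` fails): row I-6.02b is not a
consequence of the rows the kernel already held. (Bookkeeping only: it says the earlier census did
not determine `ω₁`'s scale from below, not that `𝓛^{17}` would be a sound choice in the manuscript.)
[folklore] -/
theorem admissible_not_farContourRow62 :
    ({ printedI with eom1 := 17, eg := 17 / 2 } : PartIDesign).Admissible ∧
    ({ printedI with eom1 := 17, eg := 17 / 2 } : PartIDesign).AdmissibleR5 ∧
    ¬ ({ printedI with eom1 := 17, eg := 17 / 2 } : PartIDesign).FarContourRow62 := by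
  have hπ := Real.pi_gt_three
  have hA : ({ printedI with eom1 := 17, eg := 17 / 2 } : PartIDesign).Admissible := by
    refine ⟨⟨?_, ?_, ?_, ?_, ?_, ?_, ?_, ?_, ?_, ?_, ?_, ?_, ?_, ?_⟩,
      ⟨?_, ?_, ?_, ?_, ?_, ?_, ?_, ?_, ?_, ?_, ?_, ?_⟩, ⟨?_, ?_, ?_, ?_, ?_, ?_, ?_, ?_, ?_, ?_, ?_⟩,
      ⟨?_, ?_, ?_, ?_, ?_, ?_, ?_, ?_, ?_, ?_, ?_, ?_, ?_, ?_, ?_, ?_⟩, ⟨?_, ?_, ?_, ?_⟩, ⟨?_, ?_, ?_, ?_⟩,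
      ⟨?_, ?_, ?_, ?_, ?_, ?_, ?_, ?_, ?_, ?_, ?_⟩⟩ <;> norm_num [printedI, min_def]
    linarith
  refine ⟨hA, admissibleR5_of_admissible _ hA (by norm_num [printedI]), ?_⟩
  norm_num [FarContourRow62, printedI]

/-- The one coupling the far-contour row creates with the `ε`-rows (`eeps ≤ 2ev − eom1`, `eP < eeps`,
rows G-eps.b/d): `2eP ≤ eom1 ≤ 2ev − eeps < 2ev − eP`, i.e. `3·eP < 2·ev` (`27 < 40` as printed).
[folklore] -/
theorem three_mul_eP_lt_two_mul_ev (p : PartIDesign) (hE : p.EpsilonRows) (h62 : p.FarContourRow62) :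
    3 * p.eP < 2 * p.ev := by
  obtain ⟨-, h2, -, h4⟩ := hE
  unfold FarContourRow62 at h62
  linarith

/-! ### The printed design and the Part-I floor under the v4 rows -/

/-- The printed design satisfies both part1-v4 rows (`2 < 9`, `18 ≤ 30`).
[cite: Zhang2022LandauSiegel, (2.6), (4.1)] -/
theorem printedI_rowsV4 : printedI.RowsV4 := by
  refine ⟨?_, ?_⟩ <;> norm_num [CaseSplitRow45, FarContourRow62, printedI]

/-- **The manuscript's Part-I parameter bookkeeping is internally consistent as printed, v4 rows
included** (consistency of the constraints, not truth of any analytic lemma).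
[cite: Zhang2022LandauSiegel, §§2–6] -/
theorem printedI_admissibleV4 : printedI.AdmissibleV4 :=
  ⟨printedI_admissibleR5, printedI_rowsV4⟩

/-- The Part-I floor `A > 1851.73` of `lt_of_admissibleR5` holds verbatim under the v4 rows (they only
add hypotheses). [folklore] -/
theorem lt_of_admissibleV4 (p : PartIDesign) (h : p.AdmissibleV4) (heP : p.eP = 9) (hw : p.w = 68)
    (hl1 : p.l1 = 405) (hcF : p.cF = 4) (hkF : p.kF = 20) (hc : p.cOm1 = 100) (hk5 : p.k5tau = 25)
    (hk2 : p.k2tau = 4) (heT : p.eT = 11 / 10) : (185173 / 100 : ℝ) < p.A :=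
  lt_of_admissibleR5 p h.1 heP hw hl1 hcF hkF hc hk5 hk2 heT

/-- … and the floor's witness `A = 1852` (`admissibleR5_1852`: secondary parameters as printed, so
`eP = 9`, `eom1 = 30`) satisfies the v4 rows too. [folklore] -/
theorem admissibleV4_1852 :
    ({ printedI with
        A := 1852, Athm2 := 1854, astar := 1854, e32 := 1841, e3b := 1837, m35 := 1823,
        m35p := 1746, e35 := 514.45, x35 := 717.1, e34 := 1159.6, x34 := 717.2, eF := 78.27,
        e406 := 405.8, e44 := 108.65, e36 := 500, m36 := 1835, x36 := 835, e42 := 94.2, e410 := 30.38,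
        xP21 := 717.1, C43 := 62616, e515 := 1852, ea2 := 15 } : PartIDesign).AdmissibleV4 := by
  refine ⟨admissibleR5_1852, ?_, ?_⟩ <;> norm_num [CaseSplitRow45, FarContourRow62, printedI]

/-- **The least integer `A` of the (13.3)-form Part-I bookkeeping is still `1852` under the v4 rows**:
no v4-admissible design with the printed secondary parameters has `A ≤ 1851`, and one has `A = 1852`
— the kernel twin of the cell's statement that the part1-v4 rows move no admissible-region projection
(CONSTRAINTS-v9 → v10). Bookkeeping of the manuscript's exponents, not a statement about what the
method could reach. [folklore] -/
theorem least_integer_A_V4 :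
    (∀ p : PartIDesign, p.AdmissibleV4 → p.eP = 9 → p.w = 68 → p.l1 = 405 → p.cF = 4 → p.kF = 20 →
      p.cOm1 = 100 → p.k5tau = 25 → p.k2tau = 4 → p.eT = 11 / 10 → ¬ p.A ≤ 1851) ∧
    (∃ p : PartIDesign, p.AdmissibleV4 ∧ p.A = 1852) := by
  refine ⟨fun p h heP hw hl1 hcF hkF hc hk5 hk2 heT hA => ?_, ⟨_, admissibleV4_1852, rfl⟩⟩
  have := lt_of_admissibleV4 p h heP hw hl1 hcF hkF hc hk5 hk2 heT
  linarith

end PartIDesign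

end Literature.NumberTheory.LFunctions.Zhang2022
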